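/-
Copyright (c) 2026. All rights reserved.
Released under Apache 2.0 license as described in the file LICENSE.
Authors: abc-iut cell, prover seat abc-iut-f-072 (gen 12).
-/
import Mathlib.NumberTheory.NumberField.Discriminant.Defs
import Literature.NumberTheory.NumberFields.QuadraticRamifiedLocalModel
import Literature.RingTheory.Trace.QuotientBasisDiscriminant
import Literature.RingTheory.Trace.QuadraticModelDiscriminant
import HarnessLib

/-!
# The discriminant congruence at a totally `(2,1)`-ramified prime: `d_F ≡ (4c)^a · u² (mod p^k)`

Classical algebraic number theory (no definition, no `Prop` fact, no instance).  Let `F` be a number field of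
degree `n` and `p` a rational prime ALL of whose primes `𝔭₁, …, 𝔭_a` in `𝓞_F` have ramification `(e, f) = (2, 1)`
(so `n = 2a`), and suppose ONE element `θ ∈ 𝓞_F` satisfies `θ² ≡ c (mod p^k 𝓞_F)` with `θ − t` a uniformizer
at every `𝔭ᵢ` (`c, t ∈ ℤ`).  Then

* `two_mul_card_primesOverFinset_eq_finrank` — `2a = n`;
* `span_natCast_eq_prod_sq` — `p 𝓞_F = ∏ 𝔭ᵢ²`, `span_natCast_pow_eq_prod_pow` — `p^k 𝓞_F = ∏ 𝔭ᵢ^{2k}`;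
* **`exists_modEq_unit_sq_mul_discr`** — `∃ u` invertible mod `p^k` with `(4c)^a ≡ u² · d_F (mod p^k)`.

Proof: `𝓞_F/p^k ≅ ∏ᵢ 𝓞_F/𝔭ᵢ^{2k}` (Dedekind CRT) `≅ ((ℤ/p^k)[X]/(X² − c))^a` (the local models of
`QuadraticRamifiedLocalModel`) as `ℤ/p^k`-algebras; the product power basis of the model has discriminant
`(4c)^a` (`QuadraticModelDiscriminant`), and ANY `ℤ/p^k`-basis of `𝓞_F/p^k` has discriminant `u² · (d_F mod p^k)`
(`QuotientBasisDiscriminant`).  Instances: `p = 3`, `c = −3` (every prime over `3` of the shape `ℚ₃(ζ₃)`) gives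
`d_F ≡ (−12)^a u² (mod 3^k)`; `p = 2`, `c = 3` (shape `ℚ₂(√3)`) gives `d_F ≡ 12^a u² (mod 2^k)` — the
«square class of `d_F` at `p`» without completions.
[cite: NeukirchANT1999, Ch. I §2 p. 15 (`d(α') = det(T)² d(α)`) and Ch. I §8 (8.2)]
-/

namespace Literature.NumberTheory.NumberFields

open NumberField IsDedekindDomain Polynomial UniqueFactorizationMonoid Module
open Literature.RingTheory.Trace

variable (F : Type*) [Field F] [NumberField F]

/-! ## 1. The primes over `p` when all have `(e, f) = (2, 1)` -/

/-- Members of `IsDedekindDomain.primesOverFinset (p)` are nonzero primes lying over `(p)`. [cite: NeukirchANT1999, Ch. I §8 (8.2)–(8.3)] -/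
theorem isPrime_liesOver_of_mem_primesOverFinset {p : ℕ} (hp : p.Prime) {P : Ideal (𝓞 F)}
    (hP : P ∈ IsDedekindDomain.primesOverFinset (Ideal.span {(p : ℤ)}) (𝓞 F)) :
    P.IsPrime ∧ P.LiesOver (Ideal.span {(p : ℤ)}) ∧ P ≠ ⊥ := by
  have hp0 : Ideal.span {(p : ℤ)} ≠ ⊥ := by simp [hp.ne_zero]
  haveI : (Ideal.span {(p : ℤ)}).IsMaximal :=
    Ideal.IsPrime.isMaximal (by rw [Ideal.span_singleton_prime (by exact_mod_cast hp.ne_zero)]; exact_mod_cast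
      Nat.prime_iff_prime_int.mp hp) hp0
  have h := (IsDedekindDomain.mem_primesOverFinset_iff hp0 (𝓞 F)).mp hP
  haveI := h.1
  haveI := h.2
  exact ⟨h.1, h.2, Ideal.ne_bot_of_liesOver_of_ne_bot hp0 P⟩

/-- **`2a = n`**: if every prime over `p` has `(e, f) = (2, 1)`, twice their number is the degree.
[cite: NeukirchANT1999, Ch. I §8 (8.2)–(8.3)] -/
theorem two_mul_card_primesOverFinset_eq_finrank {p : ℕ} (hp : p.Prime)
    (hall : ∀ P ∈ IsDedekindDomain.primesOverFinset (Ideal.span {(p : ℤ)}) (𝓞 F), P.ramificationIdx ℤ = 2 ∧ P.inertiaDeg ℤ = 1) :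
    2 * (IsDedekindDomain.primesOverFinset (Ideal.span {(p : ℤ)}) (𝓞 F)).card = finrank ℚ F := by
  have hp0 : Ideal.span {(p : ℤ)} ≠ ⊥ := by simp [hp.ne_zero]
  haveI : (Ideal.span {(p : ℤ)}).IsMaximal :=
    Ideal.IsPrime.isMaximal (by rw [Ideal.span_singleton_prime (by exact_mod_cast hp.ne_zero)]; exact_mod_cast
      Nat.prime_iff_prime_int.mp hp) hp0
  rw [← Ideal.sum_ramification_inertia (R := ℤ) (𝓞 F) ℚ F (p := Ideal.span {(p : ℤ)}) hp0, Finset.card_eq_sum_ones,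
    Finset.mul_sum]
  refine Finset.sum_congr rfl fun P hP => ?_
  obtain ⟨hPr, hPl, hP0⟩ := isPrime_liesOver_of_mem_primesOverFinset F hp hP
  haveI := hPr; haveI := hPl
  haveI : P.IsMaximal := hPr.isMaximal hP0
  rw [Ideal.ramificationIdx'_eq_ramificationIdx (Ideal.span {(p : ℤ)}) P hp0,
    Ideal.inertiaDeg'_eq_inertiaDeg (Ideal.span {(p : ℤ)}) P, (hall P hP).1, (hall P hP).2]

/-- **`p 𝓞_F = ∏ᵢ 𝔭ᵢ^{e_i}`** over the primes over `p`. [cite: NeukirchANT1999, Ch. I §8 (8.2)–(8.3)] -/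
theorem span_natCast_eq_prod_pow_ramificationIdx {p : ℕ} (hp : p.Prime) :
    Ideal.span {(p : 𝓞 F)} =
      ∏ P ∈ IsDedekindDomain.primesOverFinset (Ideal.span {(p : ℤ)}) (𝓞 F), P ^ P.ramificationIdx ℤ := by
  classical
  have hmap : Ideal.map (algebraMap ℤ (𝓞 F)) (Ideal.span {(p : ℤ)}) = Ideal.span {(p : 𝓞 F)} := by
    rw [Ideal.map_span, Set.image_singleton, map_natCast]
  have hM0 : Ideal.map (algebraMap ℤ (𝓞 F)) (Ideal.span {(p : ℤ)}) ≠ ⊥ := by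
    rw [hmap, ne_eq, Ideal.span_singleton_eq_bot]; exact_mod_cast hp.ne_zero
  have hprod := (prod_normalizedFactors hM0)
  rw [associated_iff_eq] at hprod
  conv_lhs => rw [← hmap, ← hprod, Finset.prod_multiset_count]
  rw [show IsDedekindDomain.primesOverFinset (Ideal.span {(p : ℤ)}) (𝓞 F) =
      (normalizedFactors (Ideal.map (algebraMap ℤ (𝓞 F)) (Ideal.span {(p : ℤ)}))).toFinset by
    rw [IsDedekindDomain.primesOverFinset, factors_eq_normalizedFactors]]
  refine Finset.prod_congr rfl fun P hP => ?_
  have hP' : P ∈ IsDedekindDomain.primesOverFinset (Ideal.span {(p : ℤ)}) (𝓞 F) := by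
    rwa [IsDedekindDomain.primesOverFinset, factors_eq_normalizedFactors]
  obtain ⟨hPr, hPl, -⟩ := isPrime_liesOver_of_mem_primesOverFinset F hp hP'
  haveI := hPr; haveI := hPl
  rw [Ideal.IsDedekindDomain.ramificationIdx_eq_normalizedFactors_count (Ideal.span {(p : ℤ)}) P hM0]

/-- If every prime over `p` has `e = 2`: `p 𝓞_F = ∏ᵢ 𝔭ᵢ²`. [cite: NeukirchANT1999, Ch. I §8 (8.2)–(8.3)] -/
theorem span_natCast_eq_prod_sq {p : ℕ} (hp : p.Prime)
    (hall : ∀ P ∈ IsDedekindDomain.primesOverFinset (Ideal.span {(p : ℤ)}) (𝓞 F), P.ramificationIdx ℤ = 2 ∧ P.inertiaDeg ℤ = 1) :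
    Ideal.span {(p : 𝓞 F)} = ∏ P ∈ IsDedekindDomain.primesOverFinset (Ideal.span {(p : ℤ)}) (𝓞 F), P ^ 2 := by
  rw [span_natCast_eq_prod_pow_ramificationIdx F hp]
  exact Finset.prod_congr rfl fun P hP => by rw [(hall P hP).1]

/-- Hence `p^k 𝓞_F = ∏ᵢ 𝔭ᵢ^{2k}`. [cite: NeukirchANT1999, Ch. I §8 (8.2)–(8.3)] -/
theorem span_natCast_pow_eq_prod_pow {p : ℕ} (hp : p.Prime)
    (hall : ∀ P ∈ IsDedekindDomain.primesOverFinset (Ideal.span {(p : ℤ)}) (𝓞 F), P.ramificationIdx ℤ = 2 ∧ P.inertiaDeg ℤ = 1)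
    (k : ℕ) :
    Ideal.span {((p ^ k : ℕ) : 𝓞 F)} = ∏ P ∈ IsDedekindDomain.primesOverFinset (Ideal.span {(p : ℤ)}) (𝓞 F), P ^ (2 * k) := by
  rw [Nat.cast_pow, ← Ideal.span_singleton_pow, span_natCast_eq_prod_sq F hp hall, ← Finset.prod_pow]
  exact Finset.prod_congr rfl fun P _ => by rw [← pow_mul]

/-! ## 2. The congruence -/

/-- **`(4c)^a ≡ u² · d_F (mod p^k)` with `u` invertible mod `p^k`**, when every prime over `p` has
`(e, f) = (2, 1)` and one `θ ∈ 𝓞_F` has `θ² ≡ c (mod p^k)` with `θ − t` a uniformizer at each of them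
(`a` = the number of primes over `p`, so `2a = [F:ℚ]`).  [cite: NeukirchANT1999, Ch. I §2 p. 15 (`d(α') = det(T)² d(α)`) and Ch. I §8 (8.2)] -/
theorem exists_modEq_unit_sq_mul_discr {p : ℕ} (hp : p.Prime) {k : ℕ} (hk : k ≠ 0)
    (hall : ∀ P ∈ IsDedekindDomain.primesOverFinset (Ideal.span {(p : ℤ)}) (𝓞 F), P.ramificationIdx ℤ = 2 ∧ P.inertiaDeg ℤ = 1)
    (c t : ℤ) (θ : 𝓞 F) (hθ : θ ^ 2 - c ∈ Ideal.span {((p ^ k : ℕ) : 𝓞 F)})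
    (hu : ∀ P ∈ IsDedekindDomain.primesOverFinset (Ideal.span {(p : ℤ)}) (𝓞 F), θ - t ∈ P ∧ θ - t ∉ P ^ 2) :
    ∃ u w : ℤ, u * w ≡ 1 [ZMOD (p ^ k : ℕ)] ∧
      (4 * c) ^ (IsDedekindDomain.primesOverFinset (Ideal.span {(p : ℤ)}) (𝓞 F)).card ≡ u ^ 2 * NumberField.discr F
        [ZMOD (p ^ k : ℕ)] := by
  classical
  -- notation
  set T := IsDedekindDomain.primesOverFinset (Ideal.span {(p : ℤ)}) (𝓞 F) with hT
  set q : ℕ := p ^ k with hq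
  have hq1 : 1 < q := Nat.one_lt_pow hk hp.one_lt
  haveI := nontrivial_int_quotient_span_natCast hq1
  set I : Ideal ℤ := Ideal.span {(q : ℤ)} with hI
  set cbar : ℤ ⧸ I := Ideal.Quotient.mk I c with hcbar
  -- (1) CRT: `𝓞_F / p^k ≅ ∏_{𝔭 ∈ T} 𝓞_F/𝔭^{2k}`
  have hmap : I.map (algebraMap ℤ (𝓞 F)) = Ideal.span {((q : ℕ) : 𝓞 F)} := by
    rw [hI, Ideal.map_span, Set.image_singleton, map_natCast]
  have hprime : ∀ i : T, Prime (i : Ideal (𝓞 F)) := fun i => by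
    obtain ⟨hPr, -, hP0⟩ := isPrime_liesOver_of_mem_primesOverFinset F hp i.2
    exact Ideal.prime_of_isPrime hP0 hPr
  have hne : Pairwise fun i j : T => (i : Ideal (𝓞 F)) ≠ j := fun i j hij h => hij (Subtype.ext h)
  have hprodT : ∏ i : T, (i : Ideal (𝓞 F)) ^ (2 * k) = Ideal.span {((q : ℕ) : 𝓞 F)} := by
    rw [hq, span_natCast_pow_eq_prod_pow F hp hall k, ← Finset.prod_coe_sort T]
  let crt : 𝓞 F ⧸ Ideal.span {((q : ℕ) : 𝓞 F)} ≃+* ∀ i : T, 𝓞 F ⧸ (i : Ideal (𝓞 F)) ^ (2 * k) :=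
    IsDedekindDomain.quotientEquivPiOfProdEq _ (fun i : T => (i : Ideal (𝓞 F))) (fun _ => 2 * k) hprime hne hprodT
  -- (2) local models at each `𝔭 ∈ T`
  have hloc : ∀ i : T, ∃ e : AdjoinRoot (X ^ 2 - C cbar) ≃+* 𝓞 F ⧸ (i : Ideal (𝓞 F)) ^ (2 * k),
      ∀ n : ℤ, e n = n := by
    intro i
    obtain ⟨hPr, -, hP0⟩ := isPrime_liesOver_of_mem_primesOverFinset F hp i.2
    let v : HeightOneSpectrum (𝓞 F) := ⟨i, hPr, hP0⟩
    have hpi : (p : 𝓞 F) ∈ v.asIdeal := by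
      have h := span_natCast_eq_prod_sq F hp hall
      have hle : Ideal.span {(p : 𝓞 F)} ≤ (i : Ideal (𝓞 F)) := by
        rw [h]
        exact Ideal.prod_le_inf.trans ((Finset.inf_le i.2).trans (Ideal.pow_le_self two_ne_zero))
      exact hle (Ideal.mem_span_singleton_self _)
    have hθi : θ ^ 2 - c ∈ v.asIdeal ^ (2 * k) := by
      have hle : Ideal.span {((q : ℕ) : 𝓞 F)} ≤ (i : Ideal (𝓞 F)) ^ (2 * k) := by
        rw [← hprodT]
        exact Ideal.prod_le_inf.trans (Finset.inf_le (Finset.mem_univ i))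
      exact hle hθ
    obtain ⟨e, -, he⟩ := exists_ringEquiv_adjoinRoot_quotient_pow v hp hpi (hall i i.2).1 (hall i i.2).2 hk c t θ
      hθi (hu i i.2).1 (hu i i.2).2
    exact ⟨e, he⟩
  choose e he using hloc
  -- (3) the composite ring isomorphism `S := 𝓞_F / I𝓞_F ≃ (T → B)` and its `ℤ/q`-linearity
  let Φ : (𝓞 F ⧸ I.map (algebraMap ℤ (𝓞 F))) ≃+* (T → AdjoinRoot (X ^ 2 - C cbar)) :=
    (Ideal.quotEquivOfEq hmap).trans (crt.trans (RingEquiv.piCongrRight fun i => (e i).symm))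
  have hΦint : ∀ n : ℤ, Φ n = n := fun n => map_intCast Φ n
  have hΦalg : ∀ a : ℤ ⧸ I, Φ (algebraMap (ℤ ⧸ I) (𝓞 F ⧸ I.map (algebraMap ℤ (𝓞 F))) a)
      = algebraMap (ℤ ⧸ I) (T → AdjoinRoot (X ^ 2 - C cbar)) a := by
    intro a
    obtain ⟨n, rfl⟩ := Ideal.Quotient.mk_surjective a
    rw [Ideal.Quotient.algebraMap_quotient_map_quotient, eq_intCast, map_intCast, hΦint]
    funext i
    have hmk : (Ideal.Quotient.mk I n : ℤ ⧸ I) = (n : ℤ ⧸ I) := by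
      rw [← map_intCast (Ideal.Quotient.mk I) n, Int.cast_id]
    rw [Pi.algebraMap_apply, Pi.intCast_apply, hmk, map_intCast]
  let Φₐ : (𝓞 F ⧸ I.map (algebraMap ℤ (𝓞 F))) ≃ₐ[ℤ ⧸ I] (T → AdjoinRoot (X ^ 2 - C cbar)) :=
    AlgEquiv.ofRingEquiv (f := Φ) hΦalg
  -- (4) the model basis and its discriminant `(4c)^a`, transported to `S`
  obtain ⟨βm, hβm⟩ := exists_basis_pi_sq_sub_discr cbar T
  let β : Basis (Fin 2 × T) (ℤ ⧸ I) (𝓞 F ⧸ I.map (algebraMap ℤ (𝓞 F))) := βm.map Φₐ.symm.toLinearEquiv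
  have hβ : Algebra.discr (ℤ ⧸ I) β = (4 * cbar) ^ Fintype.card T := by
    have hcoe : (β : Fin 2 × T → 𝓞 F ⧸ I.map (algebraMap ℤ (𝓞 F))) = Φₐ.symm ∘ βm := by
      funext x; simp [β]
    rw [hcoe, ← Algebra.discr_eq_discr_of_algEquiv βm Φₐ.symm, hβm]
  -- (5) any basis of `S` has discriminant `u² · (d_F mod q)`
  have hcard : Fintype.card (Fin 2 × T) = Fintype.card (Free.ChooseBasisIndex ℤ (𝓞 F)) := by
    rw [← Module.finrank_eq_card_chooseBasisIndex, NumberField.RingOfIntegers.rank, Fintype.card_prod,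
      Fintype.card_fin, Fintype.card_coe, two_mul_card_primesOverFinset_eq_finrank F hp hall]
  obtain ⟨u, hu'⟩ := exists_unit_sq_mul_discr_eq I (RingOfIntegers.basis F) β hcard
  -- (6) extract integers
  obtain ⟨u₀, hu₀⟩ := Ideal.Quotient.mk_surjective (u : ℤ ⧸ I)
  obtain ⟨w₀, hw₀⟩ := Ideal.Quotient.mk_surjective (↑u⁻¹ : ℤ ⧸ I)
  refine ⟨u₀, w₀, ?_, ?_⟩
  · have h1 : Ideal.Quotient.mk I (u₀ * w₀) = Ideal.Quotient.mk I 1 := by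
      rw [map_mul, hu₀, hw₀, Units.mul_inv, map_one]
    rw [Ideal.Quotient.eq, hI, Ideal.mem_span_singleton] at h1
    exact (Int.modEq_iff_dvd.mpr h1).symm
  · have h2 : Ideal.Quotient.mk I ((4 * c) ^ T.card) = Ideal.Quotient.mk I (u₀ ^ 2 * NumberField.discr F) := by
      rw [map_pow, map_mul, map_mul, map_pow, hu₀, map_ofNat, ← hcbar, ← Fintype.card_coe T, ← hβ, hu']
    rw [Ideal.Quotient.eq, hI, Ideal.mem_span_singleton] at h2
    exact (Int.modEq_iff_dvd.mpr h2).symm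

end Literature.NumberTheory.NumberFields
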